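import Summits.PneNP.PneNP.Theses.NoTardosTropics
import Summits.PneNP.PneNP.Theorems.NoTardosTropicsOracleRemoval
import Summits.PneNP.PneNP.Theorems.NoTardosTropicsGlueNoTardos
import Literature.Computability.Complexity.AdditiveRealClasses
import Literature.Computability.Complexity.MeanPayoffGame
import Literature.Computability.Complexity.OracleQueryMap
import Literature.Computability.Complexity.LengthCompare
import Literature.Computability.Complexity.BranchingFn
import Literature.Computability.Complexity.NondeterministicProofs

/-!
# Crux `XAdd` (stmt-PneNP-2563) — strategist evidence for STRATEGY-CENSUS.md

Route `PneNP/NoTardosTropics`. This scratch file (crux-strategist, BC2-redirect audit) records, as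
checked Lean, the STRUCTURE of the deciding crux `XAdd = (MPG_ℝ ∉ P⁰_add)` that defeats every
conjunctive decomposition tried in the census:

* `xadd_iff_boolHard_or_noTropicalTardos` — modulo the routine open support item
  `BooleanShadow`, `XAdd ↔ (MPGBool ∉ P) ∨ NoTropicalTardos`: the crux is, provably, a
  DISJUNCTION of two summit-or-harder statements (Boolean hardness of integer mean payoff, or
  "no tropical Frank–Tardos reduction"), each of which alone implies `XAdd`
  (`xadd_of_boolHard`, `xadd_of_noTropicalTardos` = the landed `glueNoTardos_proof`), and whose
  negations together refute it (landed `PAddRel_subset_PAdd_of_mem_P`).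
* the candidate conjunctive cuts of the census typed as Props, with the seam exhibited:
  D2 `CondNoTardos ∧ CondShadow → XAdd` is the one-line case split `em (MPGBool ∈ P)` and
  `CondNoTardos ↔ XAdd` (piece ≡ crux); D3 `ConvTransfer ∧ PneNP → XAdd` is modus ponens with the
  summit as a piece; D4 `NoLowering → XAdd` already from ONE piece (oracle `A = ∅`), so the
  companion piece `MPGBool ∈ NP ∩ coNP` is not load-bearing.

Nothing here is proposed to the tree; it is attached as evidence on the crux item.
-/

set_option linter.dupNamespace false

namespace Summit.PneNP.PneNP.Cruxes.XAdd.Strategist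

open Computability Literature.Computability.Complexity
open Summit.PneNP.PneNP.Theses.NoTardosTropics Summit.PneNP.PneNP.Theorems

/-! ## Dictionary to the named classes (all definitional) -/

theorem xadd_iff : XAdd ↔ MPGReal ∉ PAdd := Iff.rfl

theorem noTropicalTardos_iff : NoTropicalTardos ↔ MPGReal ∉ PAddRel MPGBool := Iff.rfl

theorem booleanShadow_iff : BooleanShadow ↔ (MPGReal ∈ PAdd → MPGBool ∈ Classes.P) := Iff.rfl

theorem fkLowering_iff :
    FKLoweringMPG ↔ ∃ A : Language Bool, A ∈ Nondeterministic.NP ∧ Aᶜ ∈ Nondeterministic.NP ∧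
      MPGReal ∈ PAddRel A := Iff.rfl

/-! ## The disjunctive structure of `XAdd` -/

/-- `B`: Boolean hardness of integer-weight mean payoff ("MPG ∉ P"). -/
def BoolHard : Prop := MPGBool ∉ Classes.P

/-- `B → XAdd` (through the Boolean shadow): one line. -/
theorem xadd_of_boolHard (hBS : BooleanShadow) (hB : BoolHard) : XAdd := fun hM => hB (hBS hM)

/-- `N → XAdd`: the landed glue of the route. -/
theorem xadd_of_noTropicalTardos (hN : NoTropicalTardos) : XAdd := glueNoTardos_proof hN

/-- `XAdd → B ∨ N`: if integer MPG is in `P` and real MPG reduces additively to it, the `P` oracle is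
removable (landed `PAddRel_subset_PAdd_of_mem_P`). -/
theorem boolHard_or_noTropicalTardos_of_xadd (hX : XAdd) : BoolHard ∨ NoTropicalTardos := by
  by_contra h
  rw [not_or] at h
  obtain ⟨hB, hN⟩ := h
  have hB' : MPGBool ∈ Classes.P := not_not.mp hB
  have hN' : MPGReal ∈ PAddRel MPGBool := by
    by_contra h'
    exact hN h'
  exact hX (NoTardosTropicsOracleRemoval.PAddRel_subset_PAdd_of_mem_P hB' hN')

/-- **`XAdd ↔ B ∨ N`** modulo the open (routine) support item `BooleanShadow`. -/
theorem xadd_iff_boolHard_or_noTropicalTardos (hBS : BooleanShadow) :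
    XAdd ↔ (BoolHard ∨ NoTropicalTardos) :=
  ⟨boolHard_or_noTropicalTardos_of_xadd,
    fun h => h.elim (xadd_of_boolHard hBS) xadd_of_noTropicalTardos⟩

/-! ## Census cut D2 — case split on `MPGBool ∈ P` -/

/-- Piece 1 of D2: "if integer MPG is easy there is still no tropical Tardos". -/
def CondNoTardos : Prop := MPGBool ∈ Classes.P → NoTropicalTardos

/-- Piece 2 of D2: "if integer MPG is hard then XAdd" — a THEOREM given the Boolean shadow. -/
def CondShadow : Prop := MPGBool ∉ Classes.P → XAdd

theorem condShadow_holds (hBS : BooleanShadow) : CondShadow := fun hB => xadd_of_boolHard hBS hB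

/-- The D2 assembly is a one-line excluded-middle seam — clause (b) fails. -/
theorem xadd_of_condNoTardos_condShadow (h₁ : CondNoTardos) (h₂ : CondShadow) : XAdd :=
  (em (MPGBool ∈ Classes.P)).elim (fun h => xadd_of_noTropicalTardos (h₁ h)) h₂

/-- And the only open piece of D2 is EQUIVALENT to the crux — clause (c) fails. -/
theorem condNoTardos_iff_xadd (hBS : BooleanShadow) : CondNoTardos ↔ XAdd :=
  ⟨fun h₁ => xadd_of_condNoTardos_condShadow h₁ (condShadow_holds hBS),
    fun hX hB => (boolHard_or_noTropicalTardos_of_xadd hX).resolve_left fun hB' => hB' hB⟩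

/-! ## Census cut D3 — converse transfer -/

/-- The converse of the route's (proved) transfer `XAdd → PneNP`. -/
def ConvTransfer : Prop := _root_.PneNP → XAdd

/-- D3 assembly: modus ponens with the SUMMIT as the second piece — (b) and (c) fail. -/
theorem xadd_of_convTransfer (h₁ : ConvTransfer) (h₂ : _root_.PneNP) : XAdd := h₁ h₂

/-! ## Census cut D4 — negated oracle lowering -/

/-- `¬ FKLoweringMPG`, positively: no `NP ∩ coNP` oracle lets a poly-time sign-query machine decide
real mean payoff. -/
def NoLowering : Prop :=
  ∀ A : Language Bool, A ∈ Nondeterministic.NP → Aᶜ ∈ Nondeterministic.NP → MPGReal ∉ PAddRel A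

theorem noLowering_iff_not_fkLowering : NoLowering ↔ ¬ FKLoweringMPG := by
  rw [fkLowering_iff]
  simp only [NoLowering, not_exists, not_and]

/-- `P⁰_add ⊆ P⁰_add(A)` for every Boolean oracle `A`: prefix every query with the tag `false`
(the argument of the landed `glueNoTardos_proof`, for a general `A`). -/
theorem PAdd_subset_PAddRel (A : Language Bool) : PAdd ⊆ PAddRel A := by
  rintro L ⟨M, hM, q, hrun⟩
  refine ⟨M.mapQuery (List.cons false ∘ fun z : List Bool => (boolUnpair (boolUnpair z).2).2),
    OracleAlg.isPolyTime_mapQuery encodingBoolBool hM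
      (comp_mem_FP (cons_mem_FP false) (comp_mem_FP boolUnpairSnd_mem_FP boolUnpairSnd_mem_FP)),
    q, fun n x => ?_⟩
  refine (OracleAlg.run_mapQuery M _ _ _ _ ?_ _).trans (hrun n x)
  intro i q' _ _
  simp only [Function.comp_apply, boolUnpair_boolPair]
  rfl

theorem empty_mem_P : ((∅ : Set (List Bool)) : Language Bool) ∈ Classes.P :=
  mem_P_of_mem_FP (const_mem_FP [false]) _ fun _ => ⟨fun h => h.elim, fun _ => rfl⟩

theorem univ_mem_P : ((Set.univ : Set (List Bool)) : Language Bool) ∈ Classes.P :=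
  mem_P_of_mem_FP (const_mem_FP [true]) _ fun w => ⟨fun _ => rfl, fun h => (h (Set.mem_univ w)).elim⟩

theorem empty_mem_NP : ((∅ : Set (List Bool)) : Language Bool) ∈ Nondeterministic.NP :=
  P_subset_NP_holds empty_mem_P

theorem compl_empty_mem_NP : ((∅ : Set (List Bool)) : Language Bool)ᶜ ∈ Nondeterministic.NP := by
  rw [Set.compl_empty]
  exact P_subset_NP_holds univ_mem_P

/-- D4: the single piece `NoLowering` ALREADY implies the crux (take the oracle `A = ∅`), so the
intended companion piece "`MPGBool ∈ NP ∩ coNP`" (Zwick–Paterson) is not load-bearing — (a) fails,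
and `NoLowering` is at least as strong as `XAdd` — (c) fails. -/
theorem xadd_of_noLowering (h : NoLowering) : XAdd :=
  fun hM => h _ empty_mem_NP compl_empty_mem_NP (PAdd_subset_PAddRel _ hM)

end Summit.PneNP.PneNP.Cruxes.XAdd.Strategist
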